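import Summits.RiemannHypothesis.RiemannHypothesis.Theorems.SignConeConeMagnificationKernel
import Summits.RiemannHypothesis.RiemannHypothesis.Theorems.SignConeConeMagnificationCompactness

/-!
# Route SignCone, item `ExactConeRigidity` (stmt-RiemannHypothesis-16306): the Dirichlet series of a cone
weight converges absolutely for `Re s > 1`

For a weight `c ≥ 0` with unit slack against every Weil test (in particular for every EXACT-cone weight of
this item), `Σ c(n) n^{-σ} < ∞` for every `σ > 1` (`LSeriesSummable_of_unitSlack`) — the `hsum` input of the
Landau transfer (`SignCone.riemannHypothesis_of_fakeWeight_landau`, `…_surplus`, `…_oneSided`) and of the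
continuation identity (`SignCone.LSeries_mul_weilMellin_sub_pole_eq`).

Proof (a Chebyshev bound from translate-boundedness). Fix the Slater bump `φ` of radius `1` (`Re Φ ≥ 0`
everywhere, `Re Φ > 0` on `|t| < 2`, `Φ = φ ⋆ φ̃`; `SignCone.exists_nodeNonneg_bump`) and let `m > 0` be the
minimum of `Re Φ` on `[-1, 1]`. By `SignCone.norm_fakeSum_translate_sub_le` the translated fake prime sums
`P(x) = Σₙ c(n) n^{-1/2}(Φ(log n - x) + Φ(-log n - x))` satisfy `Re P(x) ≤ B + e^{x/2}‖Φ̂(1)‖` for `x ≥ 0`; all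
terms of `Re P(x)` are `≥ 0`, and those with `k ≤ log n < k + 1` are `≥ m c(n)/√n` at `x = k`. Hence the block
`k ≤ log n < k+1` contributes at most `e^{-k(σ-1/2)} (B + e^{k/2}‖Φ̂(1)‖)/m ≤ ((B + ‖Φ̂(1)‖)/m) e^{-k(σ-1)}` to
`Σ c(n) n^{-σ}`, a convergent geometric series for `σ > 1`.
-/

noncomputable section

-- `Summit.RiemannHypothesis.RiemannHypothesis.…` repeats a namespace component by design (D-0017 layout).
set_option linter.dupNamespace false

open scoped BigOperators ComplexConjugate Real
open Complex MeasureTheory Set Filter Finset LSeries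

namespace Summit.RiemannHypothesis.RiemannHypothesis.Theorems.SignConeExactConeRigidity

open Literature.NumberTheory.LFunctions
open Summit.RiemannHypothesis.RiemannHypothesis.Theorems.SignCone

variable {c : ℕ → ℝ}

/-- A continuous function with positive real part on `|t| < 2` has real part bounded below by a positive
constant on `[-1, 1]`. -/
theorem exists_pos_le_re_of_pos {G : ℝ → ℂ} (hG : Continuous G) (hpos : ∀ t : ℝ, |t| < 2 → 0 < (G t).re) :
    ∃ m : ℝ, 0 < m ∧ ∀ t : ℝ, |t| ≤ 1 → m ≤ (G t).re := by
  have hc : ContinuousOn (fun t => (G t).re) (Icc (-1) 1) := (Complex.continuous_re.comp hG).continuousOn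
  obtain ⟨t₀, ht₀, hmin⟩ := (isCompact_Icc (a := (-1 : ℝ)) (b := 1)).exists_isMinOn
    (nonempty_Icc.2 (by norm_num)) hc
  refine ⟨(G t₀).re, hpos t₀ ?_, fun t ht => hmin (show t ∈ Icc (-1 : ℝ) 1 from ?_)⟩
  · rw [Set.mem_Icc] at ht₀
    rw [abs_lt]; constructor <;> linarith [ht₀.1, ht₀.2]
  · rw [Set.mem_Icc]; rw [abs_le] at ht; exact ⟨ht.1, ht.2⟩

/-- **The Dirichlet series of a unit-slack cone weight converges absolutely on `Re s > 1`.** If `c ≥ 0`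
has unit slack against every Weil test, `-‖φ‖₂² ≤ Re (W_ar - P_c)(φ ⋆ φ̃)`, then `Σ c(n) n^{-σ} < ∞` for every
real `σ > 1`. (Chebyshev bound from `SignCone.norm_fakeSum_translate_sub_le`; see the module docstring.) -/
theorem LSeriesSummable_of_unitSlack
    (hU : ∀ φ : ℝ → ℂ, IsWeilTest φ →
      -(∫ t, ‖φ t‖ ^ 2) ≤
        (weilPolarTerm (weilConv φ (weilReflect φ)) + weilArchTerm (weilConv φ (weilReflect φ)) -
          ∑' n : ℕ, ((c n : ℝ) : ℂ) / (Real.sqrt n : ℂ) *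
            (weilConv φ (weilReflect φ) (Real.log n) + weilConv φ (weilReflect φ) (-Real.log n))).re)
    (hc : ∀ n, 0 ≤ c n) {σ : ℝ} (hσ : 1 < σ) :
    LSeriesSummable (fun n => ((c n : ℝ) : ℂ)) σ := by
  -- the Slater bump of radius `1` and the lower bound `m` of `Re Φ` on `[-1, 1]`
  obtain ⟨φ, hφ, -, hnn, hpos⟩ := exists_nodeNonneg_bump (a := 1) one_pos
  set Φ : ℝ → ℂ := weilConv φ (weilReflect φ) with hΦ
  have hΦt : IsWeilTest Φ := hφ.weilConv hφ.weilReflect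
  obtain ⟨m, hm, hmle⟩ := exists_pos_le_re_of_pos hΦt.1.continuous (fun t ht => hpos t (by linarith))
  obtain ⟨M, hM⟩ := hΦt.1.continuous.bounded_above_of_compact_support hΦt.2
  -- the bound on translated fake prime sums
  set B : ℝ := ‖weilMellin Φ 0‖ +
      1 / (2 * π) * (∫ t : ℝ, ‖weilMellin Φ (1 / 2 + t * I) * ((Complex.digamma (1 / 4 + t / 2 * I)).re : ℂ)‖) +
      M * Real.log π + M +
      (weilPolarTerm Φ + weilArchTerm Φ -
        (∑' n : ℕ, ((c n : ℝ) : ℂ) / (Real.sqrt n : ℂ) * (Φ (Real.log n) + Φ (-Real.log n))) + Φ 0).re with hB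
  set M₁ : ℝ := ‖weilMellin Φ 1‖ with hM₁
  -- the terms `T x n = c(n)/√n (Re Φ(log n - x) + Re Φ(-log n - x)) ≥ 0` and their sum
  set T : ℝ → ℕ → ℝ := fun x n => c n / Real.sqrt n * ((Φ (Real.log n - x)).re + (Φ (-Real.log n - x)).re)
    with hT
  have hT0 : ∀ x n, 0 ≤ T x n := fun x n =>
    mul_nonneg (div_nonneg (hc n) (Real.sqrt_nonneg _)) (add_nonneg (hnn _) (hnn _))
  have hTsum : ∀ x : ℝ, 0 ≤ x → Summable (T x) ∧ ∑' n, T x n ≤ B + Real.exp (x / 2) * M₁ := by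
    intro x hx
    have hs : Summable fun n : ℕ => ((c n : ℝ) : ℂ) / (Real.sqrt n : ℂ) *
        (Φ (Real.log n - x) + Φ (-Real.log n - x)) := by
      have := summable_fakePrimeTerm c (F := weilTranslate Φ x) (hΦt.weilTranslate x).2
      simpa [weilTranslate] using this
    have hre : ∀ n : ℕ, (((c n : ℝ) : ℂ) / (Real.sqrt n : ℂ) *
        (Φ (Real.log n - x) + Φ (-Real.log n - x))).re = T x n := by
      intro n
      have e : ((c n : ℝ) : ℂ) / (Real.sqrt n : ℂ) = ((c n / Real.sqrt n : ℝ) : ℂ) := by push_cast; rfl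
      rw [e, Complex.re_ofReal_mul, Complex.add_re]
    have hsT : Summable (T x) := by
      have := (Complex.reCLM.summable hs)
      refine this.congr fun n => ?_
      simp only [Complex.reCLM_apply]
      exact hre n
    refine ⟨hsT, ?_⟩
    have hbd := norm_fakeSum_translate_sub_le hU hφ hM hx
    have hre_le : (∑' n : ℕ, ((c n : ℝ) : ℂ) / (Real.sqrt n : ℂ) *
        (Φ (Real.log n - x) + Φ (-Real.log n - x))).re ≤ B + Real.exp (x / 2) * M₁ := by
      set P : ℂ := ∑' n : ℕ, ((c n : ℝ) : ℂ) / (Real.sqrt n : ℂ) *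
        (Φ (Real.log n - x) + Φ (-Real.log n - x)) with hP
      set E : ℂ := cexp ((x : ℂ) / 2) * weilMellin Φ 1 with hE
      have h2 : ‖E‖ = Real.exp (x / 2) * M₁ := by
        rw [hE, norm_mul, Complex.norm_exp]
        simp [hM₁]
      have h3 : ‖P‖ ≤ ‖P - E‖ + ‖E‖ := by
        have := norm_sub_norm_le P E
        linarith
      have h4 : P.re ≤ ‖P‖ := (le_abs_self _).trans (Complex.abs_re_le_norm P)
      linarith
    rw [Complex.re_tsum hs] at hre_le
    rwa [tsum_congr hre] at hre_le
  have hM₁0 : 0 ≤ M₁ := norm_nonneg _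
  -- a nonnegative version of the constant
  set B₂ : ℝ := B + M₁ with hB₂
  have hB0 : 0 ≤ B₂ := by
    obtain ⟨-, h⟩ := hTsum 0 le_rfl
    have : 0 ≤ ∑' n, T 0 n := tsum_nonneg (hT0 0)
    rw [zero_div, Real.exp_zero, one_mul] at h
    linarith
  have hTsum' : ∀ x : ℝ, 0 ≤ x → Summable (T x) ∧ ∑' n, T x n ≤ B₂ + Real.exp (x / 2) * M₁ := by
    intro x hx
    obtain ⟨h1, h2⟩ := hTsum x hx
    exact ⟨h1, by linarith⟩
  -- the norms of the terms of the `L`-series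
  set gterm : ℕ → ℝ := fun n => ‖term (fun n => ((c n : ℝ) : ℂ)) σ n‖ with hg
  have hg0 : ∀ n, 0 ≤ gterm n := fun n => norm_nonneg _
  have hgval : ∀ n : ℕ, n ≠ 0 → gterm n = c n / (n : ℝ) ^ σ := by
    intro n hn
    simp only [hg, term_of_ne_zero hn, norm_div, Complex.norm_real, Real.norm_of_nonneg (hc n),
      Complex.norm_natCast_cpow_of_pos (Nat.pos_of_ne_zero hn), ofReal_re]
  -- block estimate: for `n ≥ 1` with `⌊log n⌋₊ = k`, `gterm n ≤ e^{-k(σ-1/2)} T k n / m`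
  have hblock : ∀ (k n : ℕ), n ≠ 0 → ⌊Real.log n⌋₊ = k →
      gterm n ≤ Real.exp (-(k * (σ - 1 / 2))) / m * T k n := by
    intro k n hn hk
    have hnpos : (0 : ℝ) < n := by exact_mod_cast Nat.pos_of_ne_zero hn
    have hlog0 : 0 ≤ Real.log n := Real.log_natCast_nonneg n
    have hk1 : (k : ℝ) ≤ Real.log n := by rw [← hk]; exact Nat.floor_le hlog0
    have hk2 : Real.log n < k + 1 := by rw [← hk]; exact Nat.lt_floor_add_one _
    -- `c n / n^σ = (c n / √n) · n^{-(σ - 1/2)} ≤ (c n/√n) e^{-k(σ-1/2)}`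
    have hpow : (n : ℝ) ^ σ = Real.sqrt n * (n : ℝ) ^ (σ - 1 / 2) := by
      rw [Real.sqrt_eq_rpow, ← Real.rpow_add hnpos]
      congr 1; ring
    have hexp : ((n : ℝ) ^ (σ - 1 / 2))⁻¹ ≤ Real.exp (-(k * (σ - 1 / 2))) := by
      rw [← Real.exp_log (Real.rpow_pos_of_pos hnpos _), ← Real.exp_neg, Real.exp_le_exp,
        Real.log_rpow hnpos]
      nlinarith
    have hsq : 0 < Real.sqrt n := Real.sqrt_pos.2 hnpos
    have hrp : 0 < (n : ℝ) ^ (σ - 1 / 2) := Real.rpow_pos_of_pos hnpos _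
    -- `T k n ≥ m c(n)/√n`
    have hTge : m * (c n / Real.sqrt n) ≤ T k n := by
      have h1 : m ≤ (Φ (Real.log n - k)).re := hmle _ (by rw [abs_le]; constructor <;> linarith)
      have h2 : 0 ≤ (Φ (-Real.log n - k)).re := hnn _
      simp only [hT]
      have hcn : 0 ≤ c n / Real.sqrt n := div_nonneg (hc n) hsq.le
      nlinarith
    rw [hgval n hn, hpow, div_mul_eq_div_div]
    calc c n / Real.sqrt n / (n : ℝ) ^ (σ - 1 / 2)
        = (c n / Real.sqrt n) * ((n : ℝ) ^ (σ - 1 / 2))⁻¹ := by rw [div_eq_mul_inv]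
      _ ≤ (c n / Real.sqrt n) * Real.exp (-(k * (σ - 1 / 2))) :=
          mul_le_mul_of_nonneg_left hexp (div_nonneg (hc n) hsq.le)
      _ ≤ (T k n / m) * Real.exp (-(k * (σ - 1 / 2))) := by
          refine mul_le_mul_of_nonneg_right ?_ (Real.exp_pos _).le
          rw [le_div_iff₀ hm]; linarith
      _ = Real.exp (-(k * (σ - 1 / 2))) / m * T k n := by ring
  -- the sum over a block is at most `((B + M₁)/m) e^{-k(σ-1)}`
  set q : ℝ := Real.exp (-(σ - 1)) with hq
  have hq0 : 0 ≤ q := (Real.exp_pos _).le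
  have hq1 : q < 1 := Real.exp_lt_one_iff.2 (by linarith)
  have hblocksum : ∀ (N k : ℕ), ∑ n ∈ (range N).filter (fun n : ℕ => ⌊Real.log (n : ℝ)⌋₊ = k), gterm n ≤
      (B₂ + M₁) / m * q ^ k := by
    intro N k
    obtain ⟨hsT, hle⟩ := hTsum' k (Nat.cast_nonneg k)
    have h1 : ∑ n ∈ (range N).filter (fun n : ℕ => ⌊Real.log (n : ℝ)⌋₊ = k), gterm n ≤
        ∑ n ∈ (range N).filter (fun n : ℕ => ⌊Real.log (n : ℝ)⌋₊ = k), Real.exp (-(k * (σ - 1 / 2))) / m * T k n := by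
      refine Finset.sum_le_sum fun n hn => ?_
      rw [Finset.mem_filter] at hn
      rcases eq_or_ne n 0 with rfl | hn0
      · simp only [hg, term_zero, norm_zero]
        exact mul_nonneg (div_nonneg (Real.exp_pos _).le hm.le) (hT0 _ _)
      · exact hblock k n hn0 hn.2
    refine h1.trans ?_
    rw [← Finset.mul_sum]
    have h2 : ∑ n ∈ (range N).filter (fun n : ℕ => ⌊Real.log (n : ℝ)⌋₊ = k), T k n ≤ B₂ + Real.exp (k / 2) * M₁ :=
      (hsT.sum_le_tsum _ fun n _ => hT0 _ _).trans hle
    have h3 : Real.exp (-(k * (σ - 1 / 2))) / m * (B₂ + Real.exp (k / 2) * M₁) ≤ (B₂ + M₁) / m * q ^ k := by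
      have e1 : Real.exp (-(k * (σ - 1 / 2))) * Real.exp (k / 2) = q ^ k := by
        rw [hq, ← Real.exp_nat_mul, ← Real.exp_add]
        congr 1; ring
      have e2 : Real.exp (-(k * (σ - 1 / 2))) ≤ q ^ k := by
        rw [hq, ← Real.exp_nat_mul, Real.exp_le_exp]
        nlinarith [(Nat.cast_nonneg k : (0 : ℝ) ≤ k)]
      have h4 : Real.exp (-(k * (σ - 1 / 2))) * (B₂ + Real.exp (k / 2) * M₁) ≤ (B₂ + M₁) * q ^ k := by
        calc Real.exp (-(k * (σ - 1 / 2))) * (B₂ + Real.exp (k / 2) * M₁)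
            = Real.exp (-(k * (σ - 1 / 2))) * B₂ + (Real.exp (-(k * (σ - 1 / 2))) * Real.exp (k / 2)) * M₁ := by
              ring
          _ = Real.exp (-(k * (σ - 1 / 2))) * B₂ + q ^ k * M₁ := by rw [e1]
          _ ≤ q ^ k * B₂ + q ^ k * M₁ := by
              have := mul_le_mul_of_nonneg_right e2 hB0
              linarith
          _ = (B₂ + M₁) * q ^ k := by ring
      have h5 : Real.exp (-(k * (σ - 1 / 2))) / m * (B₂ + Real.exp (k / 2) * M₁) =
          Real.exp (-(k * (σ - 1 / 2))) * (B₂ + Real.exp (k / 2) * M₁) / m := by ring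
      have h6 : (B₂ + M₁) / m * q ^ k = (B₂ + M₁) * q ^ k / m := by ring
      rw [h5, h6]
      exact div_le_div_of_nonneg_right h4 hm.le
    exact (mul_le_mul_of_nonneg_left h2 (div_nonneg (Real.exp_pos _).le hm.le)).trans h3
  -- partial sums are bounded, hence the series of nonnegative terms converges
  have hpartial : ∀ N : ℕ, ∑ n ∈ range N, gterm n ≤ (B₂ + M₁) / m * (1 - q)⁻¹ := by
    intro N
    have hmaps : ∀ n ∈ range N, ⌊Real.log (n : ℝ)⌋₊ ∈ range (N + 1) := by
      intro n hn
      rw [Finset.mem_range] at hn ⊢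
      have h1 : ⌊Real.log n⌋₊ ≤ n := by
        rcases eq_or_ne n 0 with rfl | hn0
        · simp
        refine Nat.floor_le_of_le ?_
        have := Real.add_one_le_exp (Real.log n)
        rw [Real.exp_log (by exact_mod_cast Nat.pos_of_ne_zero hn0)] at this
        linarith
      omega
    rw [← Finset.sum_fiberwise_of_maps_to hmaps]
    calc ∑ k ∈ range (N + 1), ∑ n ∈ (range N).filter (fun n : ℕ => ⌊Real.log (n : ℝ)⌋₊ = k), gterm n
        ≤ ∑ k ∈ range (N + 1), (B₂ + M₁) / m * q ^ k := Finset.sum_le_sum fun k _ => hblocksum N k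
      _ = (B₂ + M₁) / m * ∑ k ∈ range (N + 1), q ^ k := by rw [Finset.mul_sum]
      _ ≤ (B₂ + M₁) / m * (1 - q)⁻¹ := by
          refine mul_le_mul_of_nonneg_left ?_ (div_nonneg (by positivity) hm.le)
          have := (summable_geometric_of_lt_one hq0 hq1).sum_le_tsum (range (N + 1)) (fun k _ => pow_nonneg hq0 k)
          rwa [tsum_geometric_of_lt_one hq0 hq1] at this
  have hsumm : Summable gterm := summable_of_sum_range_le hg0 hpartial
  exact Summable.of_norm hsumm

end Summit.RiemannHypothesis.RiemannHypothesis.Theorems.SignConeExactConeRigidity
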